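import Summits.HubbardSuperconductivity.HubbardSuperconductivity.Theorems.AnisotropyChordTransferExclusionGap
import Summits.HubbardSuperconductivity.HubbardSuperconductivity.Theorems.AnisotropyChordTransferNearEnd
import Summits.HubbardSuperconductivity.HubbardSuperconductivity.Theorems.AnisotropyChordTransferTwoMagnon

/-!
# Route `AnisotropyChord` / H0 rotor rung, route (1): UNCONDITIONAL COROLLARIES OF `ferroSectorGapCLR_holds`

With the named hypothesis `FerroSectorGapCLR` now a theorem (`…TransferExclusionGap.ferroSectorGapCLR_holds`), the two tree
results that took it as a hypothesis become unconditional: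

* `twoMagnonFerroGap_holds : TwoMagnonFerroGap` (PART N20: the ferromagnetic value of the two-magnon sector gap,
  `γ₂(1, L) ≥ 1 − cos(2π/L)`, `L ≥ 3`);
* `nearEnd_holds` / `nearEnd_uniform_holds` (PART N21(b), THEOREM near-END in every sector): for `Δ ≤ 1`, `L ≥ 3` and every
  sector `M`, `SectorGapAtLeast L Δ M (1 − cos(2π/L) − t)` for every `t ≥ groundLift L Δ M`, in particular with the uniform-trial
  tangent bound `t = (1 − Δ)·2n(n − 1)/(|V| − 1)`, `n = |V|/2 + M`.

Prover seat `hubbard-h0-rotor-p1` g20; helper for the S-bridge dossier of stmt-HubbardSuperconductivity-19089.  No definition is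
introduced; nothing here is a statement about the Hubbard model.
-/

set_option linter.dupNamespace false
set_option autoImplicit false

noncomputable section

open Literature.MathematicalPhysics.QuantumLattice Literature.Probability.LatticeModels

namespace Summit.HubbardSuperconductivity.HubbardSuperconductivity.Theorems.AnisotropyChord.Transfer

/-- **`TwoMagnonFerroGap` holds**: `γ₂(1, L) ≥ 1 − cos(2π/L)` on every `L × L` torus, `L ≥ 3` (Temple form).
[cite: CaputoLiggettRichthammer2010, Theorem 1.1] -/
theorem twoMagnonFerroGap_holds : TwoMagnonFerroGap :=
  twoMagnonFerroGap_of_CLR ferroSectorGapCLR_holds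

/-- **THEOREM near-END, unconditional:** for `Δ ≤ 1`, `L ≥ 3`, every sector `M` and every `t ≥ groundLift L Δ M`,
`SectorGapAtLeast L Δ M (1 − cos(2π/L) − t)`. [cite: CaputoLiggettRichthammer2010, Theorem 1.1] -/
theorem nearEnd_holds {L : ℕ} [NeZero L] (hL : 3 ≤ L) {Δ M t : ℝ} (hΔ : Δ ≤ 1) (ht : groundLift L Δ M ≤ t) :
    SectorGapAtLeast L Δ M (1 - Real.cos (2 * Real.pi / (L : ℝ)) - t) :=
  nearEnd_of_ferroSectorGapCLR ferroSectorGapCLR_holds hL hΔ ht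

/-- **THEOREM near-END with the uniform-trial tangent bound, unconditional:** for `Δ ≤ 1`, `L ≥ 3` and every sector `M`
(`n = |V|/2 + M` particles), `γ(Δ, L, M) ≥ (1 − cos 2π/L) − (1 − Δ)·2n(n−1)/(|V| − 1)` in Temple form.
[cite: CaputoLiggettRichthammer2010, Theorem 1.1] -/
theorem nearEnd_uniform_holds {L : ℕ} [NeZero L] (hL : 3 ≤ L) {Δ : ℝ} (hΔ : Δ ≤ 1) (M : ℝ) :
    SectorGapAtLeast L Δ M
      (1 - Real.cos (2 * Real.pi / (L : ℝ))
        - (1 - Δ) * (2 * ((Fintype.card (TorusSite 2 L) : ℝ) / 2 + M) * (((Fintype.card (TorusSite 2 L) : ℝ) / 2 + M) - 1))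
            / ((Fintype.card (TorusSite 2 L) : ℝ) - 1)) :=
  nearEnd_uniform ferroSectorGapCLR_holds hL hΔ M


/-! ## CONJECTURE GM ⇒ BEC, without the SEP-gap hypothesis (appended, prover seat g20) -/

open Summit.HubbardSuperconductivity.HubbardSuperconductivity.Theorems.AnisotropyChord.Tower

/-- **GM (endpoint form) ⇒ the `1/|V|` symmetric gap with every `C < 2π²`**, the SEP sector gap being a theorem
(`ferroSectorGapCLR_holds`). [cite: CaputoLiggettRichthammer2010, Theorem 1.1] -/
theorem symmetricSectorGapInvV_of_gapDominatesFerro' {Δ₀ Δ C : ℝ} {k : ℕ} (h0 : Δ₀ ≤ Δ) (h1 : Δ ≤ 1)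
    (hGM : GapDominatesFerro Δ₀ k) (hC : C < 2 * Real.pi ^ 2) :
    SymmetricSectorGapInvV Δ C k :=
  symmetricSectorGapInvV_of_gapDominatesFerro h0 h1 hGM ferroSectorGapCLR_holds hC

/-- the same from the monotone form of CONJECTURE GM. [cite: CaputoLiggettRichthammer2010, Theorem 1.1] -/
theorem symmetricSectorGapInvV_of_anisotropyGapMonotone' {Δ₀ Δ C : ℝ} {k : ℕ} (h0 : Δ₀ ≤ Δ) (h1 : Δ ≤ 1)
    (hGM : AnisotropyGapMonotone Δ₀ k) (hC : C < 2 * Real.pi ^ 2) :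
    SymmetricSectorGapInvV Δ C k :=
  symmetricSectorGapInvV_of_anisotropyGapMonotone h0 h1 hGM ferroSectorGapCLR_holds hC

/-- **COROLLARY (BEC from GM), with the SEP-gap hypothesis discharged:** `0 ≤ Δ < 1`, anchor `c₀`, CONJECTURE GM on
`[Δ₀, 1] ∋ Δ` for the sectors `|j| ≤ k+1`, and the chain threshold `2(k+1)·Σ_{i≤k} D_i(1−Δ, c₀/4) < 2π²·c₀` ⇒
`CondensateOnFirstSectors Δ k`.  The only remaining hypotheses are the anchor and CONJECTURE GM.
[cite: CaputoLiggettRichthammer2010, Theorem 1.1] -/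
theorem condensateOnFirstSectors_of_gapDominatesFerro' {Δ₀ Δ c₀ : ℝ} {k : ℕ} (hΔ₀ : Δ₀ ≤ Δ) (hΔ0 : 0 ≤ Δ)
    (hΔ1 : Δ < 1) (hc₀ : 0 < c₀) (hA : HalfFillingAnchor Δ c₀) (hGM : GapDominatesFerro Δ₀ (k + 1))
    (hsmall : 2 * ((k : ℝ) + 1) * (∑ i ∈ Finset.range (k + 1), dSeq (1 - Δ) (c₀ / 4) i) < 2 * Real.pi ^ 2 * c₀) :
    CondensateOnFirstSectors Δ k :=
  condensateOnFirstSectors_of_gapDominatesFerro hΔ₀ hΔ0 hΔ1 hc₀ hA hGM ferroSectorGapCLR_holds hsmall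

end Summit.HubbardSuperconductivity.HubbardSuperconductivity.Theorems.AnisotropyChord.Transfer

end
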